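import Literature.Barriers.ValiantsHypothesis.BDGIL24GelfandTsetlinProjectorLength
import Literature.Barriers.ValiantsHypothesis.BDGIL24CasimirGenerators
import Literature.Barriers.ValiantsHypothesis.BDGIL24PerelomovPopov
import HarnessLib

/-!
# [BDGIL24, §4.5]: the Gelfand–Tsetlin algebra `GZ(gl_k) ⊂ U(gl_k)` — generated by the centres
# `Z(gl_ℓ)`, `ℓ ≤ k`, COMMUTATIVE, generated by the Casimir elements `C_{ℓ,p}` of eq. (14), which
# have length `≤ k` and act on the `T`-isotypic spaces by the scalars `χ_T(C_{ℓ,p})` — PROVED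
# (`BergEtAl2024.gzAlgebra_commute`, `BergEtAl2024.gzAlgebra_eq_adjoin_casimirLevel`,
#  `BergEtAl2024.envActGL_casimirLevel_apply_of_mem_gtSubspace`)

[BDGIL24] = M. van den Berg, P. Dutta, F. Gesmundo, C. Ikenmeyer, V. Lysikov, *Algebraic
metacomplexity and representation theory*, arXiv:2411.03444, §4.5 (p.22–23, PDF p.23–24; held text
paper:arxiv-2411.03444 p0023.txt:L35–L47, p0024.txt:L2–L13, L55–L57):

> "The inclusions `𝔤_ℓ ⊆ 𝔤_k` give an inclusion of universal enveloping algebras `U(𝔤_ℓ) ⊆ U(𝔤_k)`,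
> and therefore a chain `U(𝔤₁) ⊂ U(𝔤₂) ⊂ ⋯ ⊂ U(𝔤_k)`. The Gelfand–Tsetlin algebra `GZ(𝔤_k)` of `𝔤_k`
> is the subalgebra of `U(𝔤)` generated by all centers `Z(𝔤_ℓ)` with `ℓ ≤ k`. Since the center
> `Z(𝔤_ℓ)` of `U(𝔤_ℓ)` commutes with all elements of `U(𝔤_ℓ)`, it commutes in particular with the
> centers `Z(𝔤_j)` for `j < ℓ`; as a result, `GZ(𝔤_k)` is a commutative subalgebra." … "The
> Gelfand–Tsetlin algebra in this case is the polynomial algebra `GZ(𝔤_k) = ℂ[C_{ℓ,p}]` generated by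
> the Casimir elements `C_{ℓ,p} := Σ_{i₁=1}^ℓ ⋯ Σ_{i_p=1}^ℓ E_{i₁i₂}E_{i₂i₃}⋯E_{i_pi₁}` with
> `1 ≤ ℓ ≤ k` and `1 ≤ p ≤ ℓ`. (14)" … "the operators `C_{ℓ,p}` of `GZ(gl_k)` act on this space as
> multiplications by the corresponding eigenvalues `χ_T(C_{ℓ,p})`." Table 5.3: generators
> `{C_{ℓ,p} | ℓ ∈ [k], p ∈ [ℓ]}`, "Generator lengths `≤ k`".

## What is typed and proved

In the block model `U(T → gl_ℓ)` of the tree (chain maps `envLiftT`, `BDGIL24GelfandTsetlinProjectorLength`):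
* `envLiftT_envLiftT` — the chain `U(𝔤_j) ⊂ U(𝔤_ℓ) ⊂ U(𝔤_k)` composes (`lieLiftMat_lieLiftMat`);
* `casimirLevel k h τ p` — **`C_{ℓ,p}` of (14)** (`= envLiftT h (HCCore.casimir ℓ τ p)`),
  `casimirLevel_mem_fil` (length `≤ p`), `casimirLevel_mem_fil_of_le` (**length `≤ k`**, Table 5.3);
* `gzAlgebra T k` — **`GZ(gl_k)`**, the subalgebra generated by the images of all centres `Z(𝔤_ℓ)`,
  `ℓ ≤ k`; **`gzAlgebra_commute`** — it is COMMUTATIVE (the printed argument: `Z(𝔤_ℓ)` commutes with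
  `U(𝔤_ℓ) ⊇ Z(𝔤_j)`, `j ≤ ℓ`; `envLiftT_center_commute`); `casimirLevel_mem_gzAlgebra`;
* **`gzAlgebra_eq_adjoin_casimirLevel`** — for one block (`T₀ = (ℝ →ₐ[ℝ] ℂ)`, where the tree's
  Thm. 4.13 `center_eq_adjoin_casimir` lives): `GZ(gl_k)` is GENERATED by the `C_{ℓ,p}`,
  `1 ≤ p ≤ ℓ ≤ k` — the generation clause of "`GZ(𝔤_k) = ℂ[C_{ℓ,p}]`"; the joint algebraic
  independence of the `k(k+1)/2` generators (the word "polynomial algebra") is NOT typed (level by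
  level it is `algebraicIndependent_casimirC`);
* **`envActGL_casimirLevel_apply_of_mem_gtSubspace`** — on the `T`-isotypic space of the degree-`δ`
  metapolynomials, `C_{ℓ,p}` acts by the scalar `χ_{λ^{(ℓ)}}(C_p) = Tr(A_{λ^{(ℓ)}}^p E)`
  (`envLiftT_center_apply_of_mem_hwSubrep` + the Perelomov–Popov value `eval_hcProj_casimir_eq_trace`).
* **`exists_gzAlgebra_separates`** — "Theorem 4.11 implies that different Gelfand–Tsetlin patterns
  correspond to different Gelfand–Tsetlin characters": two distinct patterns occurring in degree `δ`
  are separated by an element of `GZ(gl_k)` of length `≤ k` (one block).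

Honest framing: representation-theoretic bookkeeping; nothing here bears on `VP ≠ VNP`.

## References
* [BergEtAl2024] arXiv:2411.03444, §4.5 (p.22–23), eq. (14), Table 5.3 (p.26).
-/

noncomputable section

-- Mathlib idiom: the commutator bracket on an associative algebra (`T → Matrix (Fin k) (Fin k) ℂ`),
-- as in the imported `BDGIL24CentralCharacters` / `HarishChandraCore`
attribute [local instance 100] LieRing.ofAssociativeRing

open MvPolynomial UniversalEnvelopingAlgebra
open scoped BigOperators

namespace Literature.Barriers.ValiantsHypothesis

namespace BergEtAl2024

open Literature.Computability.AlgebraicComplexity Literature.NumberTheory.DiophantineGeometry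
open Literature.NumberTheory.Automorphic Literature.NumberTheory.Automorphic.HCCore

/-! ### The chain `U(𝔤_j) ⊂ U(𝔤_ℓ) ⊂ U(𝔤_k)` composes -/

section Chain

variable {K : Type*} [CommRing K] {j ℓ k : ℕ} {T : Type*}

/-- `diag(diag(N,0),0) = diag(N,0)`: the upper-left-block inclusions compose.
[cite: BergEtAl2024, §4.5, p.22–23 (PDF p.23–24)] locator: paper:arxiv-2411.03444 p0023.txt:L35–L36 -/
theorem lieLiftMat_lieLiftMat (h : j ≤ ℓ) (h' : ℓ ≤ k) (N : Matrix (Fin j) (Fin j) K) :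
    lieLiftMat h' (lieLiftMat h N) = lieLiftMat (h.trans h') N := by
  ext a b
  simp only [lieLiftMat_apply_eq]
  split_ifs <;> first | rfl | omega

/-- The Lie algebra inclusions `gl_j^T ⊂ gl_ℓ^T ⊂ gl_k^T` compose.
[cite: BergEtAl2024, §4.5, p.22 (PDF p.23)] locator: paper:arxiv-2411.03444 p0023.txt:L35–L36 -/
theorem liftLieT_liftLieT (h : j ≤ ℓ) (h' : ℓ ≤ k) (X : T → Matrix (Fin j) (Fin j) ℂ) :
    liftLieT h' (liftLieT h X) = liftLieT (T := T) (h.trans h') X := by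
  funext τ
  rw [liftLieT_apply, liftLieT_apply, liftLieT_apply, lieLiftMat_lieLiftMat]

/-- **The chain `U(𝔤_j) ⊂ U(𝔤_ℓ) ⊂ U(𝔤_k)` composes**: `envLiftT h' ∘ envLiftT h = envLiftT (h ≫ h')`.
[cite: BergEtAl2024, §4.5, p.22 (PDF p.23)] locator: paper:arxiv-2411.03444 p0023.txt:L35–L36 -/
theorem envLiftT_envLiftT (h : j ≤ ℓ) (h' : ℓ ≤ k)
    (u : UniversalEnvelopingAlgebra ℂ (T → Matrix (Fin j) (Fin j) ℂ)) :
    envLiftT h' (envLiftT h u) = envLiftT (T := T) (h.trans h') u := by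
  have hcomp : (envLiftT (T := T) h').comp (envLiftT h) = envLiftT (h.trans h') := by
    apply UniversalEnvelopingAlgebra.hom_ext
    refine LieHom.ext fun X => ?_
    change envLiftT h' (envLiftT h (UniversalEnvelopingAlgebra.ι ℂ X)) =
      envLiftT (h.trans h') (UniversalEnvelopingAlgebra.ι ℂ X)
    rw [envLiftT_ι, envLiftT_ι, envLiftT_ι, liftLieT_liftLieT]
  rw [← AlgHom.comp_apply, hcomp]

/-- Central elements of `U(𝔤_ℓ)` commute, inside `U(𝔤_k)`, with the image of `U(𝔤_j)`, `j ≤ ℓ` ("the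
center `Z(𝔤_ℓ)` of `U(𝔤_ℓ)` commutes with all elements of `U(𝔤_ℓ)`, … in particular with the centers
`Z(𝔤_j)` for `j < ℓ`"). [cite: BergEtAl2024, §4.5, p.22 (PDF p.23)] locator: paper:arxiv-2411.03444 p0023.txt:L37–L39 -/
theorem envLiftT_center_commute (h : j ≤ ℓ) (h' : ℓ ≤ k)
    {z : UniversalEnvelopingAlgebra ℂ (T → Matrix (Fin ℓ) (Fin ℓ) ℂ)}
    (hz : z ∈ Subalgebra.center ℂ (UniversalEnvelopingAlgebra ℂ (T → Matrix (Fin ℓ) (Fin ℓ) ℂ)))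
    (w : UniversalEnvelopingAlgebra ℂ (T → Matrix (Fin j) (Fin j) ℂ)) :
    Commute (envLiftT (T := T) h' z) (envLiftT (h.trans h') w) := by
  rw [← envLiftT_envLiftT h h', Commute, SemiconjBy, ← map_mul, ← map_mul,
    Subalgebra.mem_center_iff.1 hz (envLiftT h w)]

end Chain

/-! ### The Casimir elements `C_{ℓ,p}` of (14) and the Gelfand–Tsetlin algebra -/

section GZ

attribute [local instance] Literature.NumberTheory.Automorphic.HCCore.idxLinearOrder

open Literature.Algebra.Lie.PBW

variable {ℓ k : ℕ} {T : Type*} [Fintype T] [DecidableEq T]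

/-- **The Casimir element `C_{ℓ,p} ∈ U(gl_k)` of [BDGIL24, (14)]**:
`C_{ℓ,p} = Σ_{i₁,…,i_p ≤ ℓ} E_{i₁i₂}E_{i₂i₃}⋯E_{i_pi₁}`, i.e. the Casimir element `C_p = tr(𝔼^p)` of
`gl_ℓ` (`HCCore.casimir ℓ`, eq. (8)) pushed into `U(gl_k)` along the chain (block `τ`).
[cite: BergEtAl2024, eq. (14), p.23 (PDF p.24)] locator: paper:arxiv-2411.03444 p0024.txt:L6–L13 -/
def casimirLevel (k : ℕ) (h : ℓ ≤ k) (τ : T) (p : ℕ) :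
    UniversalEnvelopingAlgebra ℂ (T → Matrix (Fin k) (Fin k) ℂ) :=
  envLiftT h (casimir ℓ τ p)

/-- `C_{ℓ,p}` has length `≤ p`. [cite: BergEtAl2024, §4.3 and Table 5.3, p.19 and p.26 (PDF p.20, p.27)] -/
theorem casimirLevel_mem_fil (h : ℓ ≤ k) (τ : T) (p : ℕ) :
    casimirLevel k h τ p ∈ fil (stdB T k) p :=
  envLiftT_mem_fil h (casimir_mem_fil τ p)

/-- **"Generator lengths `≤ k`"** (Table 5.3, third column): `C_{ℓ,p}`, `p ≤ ℓ ≤ k`, has length `≤ k`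
("For the chain `gl_1 ⊂ ⋯ ⊂ gl_k`, Casimir elements have length at most `k`").
[cite: BergEtAl2024, Table 5.3 and §5.1.4, p.26 and p.28 (PDF p.27, p.29)] locator: paper:arxiv-2411.03444 p0027.txt:L7, p0029.txt:L14–L15 -/
theorem casimirLevel_mem_fil_of_le (h : ℓ ≤ k) (τ : T) {p : ℕ} (hp : p ≤ ℓ) :
    casimirLevel k h τ p ∈ fil (stdB T k) k :=
  fil_mono (stdB T k) (hp.trans h) (casimirLevel_mem_fil h τ p)

/-- `C_{ℓ,p}` is the image of a central element of `U(gl_ℓ)`. [cite: BergEtAl2024, §4.5, p.22 (PDF p.23)] -/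
theorem casimir_mem_center_level (τ : T) (p : ℕ) :
    casimir ℓ τ p ∈ Subalgebra.center ℂ (UniversalEnvelopingAlgebra ℂ (T → Matrix (Fin ℓ) (Fin ℓ) ℂ)) :=
  casimir_mem_center τ p

variable (T) in
/-- **The Gelfand–Tsetlin algebra `GZ(gl_k) ⊂ U(gl_k)`**: "the subalgebra of `U(𝔤)` generated by all
centers `Z(𝔤_ℓ)` with `ℓ ≤ k`" (the centres pushed into `U(gl_k)` along the chain `envLiftT`).
[cite: BergEtAl2024, §4.5, p.22 (PDF p.23)] locator: paper:arxiv-2411.03444 p0023.txt:L36–L37 -/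
def gzAlgebra (k : ℕ) : Subalgebra ℂ (UniversalEnvelopingAlgebra ℂ (T → Matrix (Fin k) (Fin k) ℂ)) :=
  Algebra.adjoin ℂ (⋃ ℓ : Fin (k + 1), envLiftT (T := T) (level_le ℓ) ''
    (Subalgebra.center ℂ (UniversalEnvelopingAlgebra ℂ (T → Matrix (Fin ℓ) (Fin ℓ) ℂ)) : Set _))

omit [Fintype T] [DecidableEq T] in
/-- The image of each centre `Z(𝔤_ℓ)`, `ℓ ≤ k`, lies in `GZ(gl_k)`. [cite: BergEtAl2024, §4.5, p.22 (PDF p.23)] -/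
theorem envLiftT_mem_gzAlgebra (ℓ' : Fin (k + 1))
    {z : UniversalEnvelopingAlgebra ℂ (T → Matrix (Fin ℓ') (Fin ℓ') ℂ)}
    (hz : z ∈ Subalgebra.center ℂ (UniversalEnvelopingAlgebra ℂ (T → Matrix (Fin ℓ') (Fin ℓ') ℂ))) :
    envLiftT (level_le ℓ') z ∈ gzAlgebra T k :=
  Algebra.subset_adjoin (Set.mem_iUnion.2 ⟨ℓ', z, hz, rfl⟩)

/-- `C_{ℓ,p} ∈ GZ(gl_k)`. [cite: BergEtAl2024, §4.5 eq. (14), p.23 (PDF p.24)] -/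
theorem casimirLevel_mem_gzAlgebra (ℓ' : Fin (k + 1)) (τ : T) (p : ℕ) :
    casimirLevel k (level_le ℓ') τ p ∈ gzAlgebra T k :=
  envLiftT_mem_gzAlgebra ℓ' (casimir_mem_center_level τ p)

omit [Fintype T] [DecidableEq T] in
/-- The generators of `GZ(gl_k)` pairwise commute (centres of the larger level commute with the
image of the smaller level). [cite: BergEtAl2024, §4.5, p.22 (PDF p.23)] locator: paper:arxiv-2411.03444 p0023.txt:L37–L39 -/
theorem gzGenerators_commute {x y : UniversalEnvelopingAlgebra ℂ (T → Matrix (Fin k) (Fin k) ℂ)}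
    (hx : x ∈ ⋃ ℓ : Fin (k + 1), envLiftT (T := T) (level_le ℓ) ''
      (Subalgebra.center ℂ (UniversalEnvelopingAlgebra ℂ (T → Matrix (Fin ℓ) (Fin ℓ) ℂ)) : Set _))
    (hy : y ∈ ⋃ ℓ : Fin (k + 1), envLiftT (T := T) (level_le ℓ) ''
      (Subalgebra.center ℂ (UniversalEnvelopingAlgebra ℂ (T → Matrix (Fin ℓ) (Fin ℓ) ℂ)) : Set _)) :
    Commute x y := by
  obtain ⟨ℓ₁, hx⟩ := Set.mem_iUnion.1 hx
  obtain ⟨z₁, hz₁, rfl⟩ := hx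
  obtain ⟨ℓ₂, hy⟩ := Set.mem_iUnion.1 hy
  obtain ⟨z₂, hz₂, rfl⟩ := hy
  rcases le_total (ℓ₂ : ℕ) ℓ₁ with h | h
  · -- `z₁` is central at the larger level
    have e : envLiftT (T := T) (level_le ℓ₂) z₂ = envLiftT (h.trans (level_le ℓ₁)) z₂ := rfl
    rw [e]
    exact envLiftT_center_commute h (level_le ℓ₁) hz₁ z₂
  · have e : envLiftT (T := T) (level_le ℓ₁) z₁ = envLiftT (h.trans (level_le ℓ₂)) z₁ := rfl
    rw [e]
    exact (envLiftT_center_commute h (level_le ℓ₂) hz₂ z₁).symm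

omit [Fintype T] [DecidableEq T] in
/-- **`GZ(gl_k)` is a commutative subalgebra** ("Since the center `Z(𝔤_ℓ)` of `U(𝔤_ℓ)` commutes with
all elements of `U(𝔤_ℓ)`, it commutes in particular with the centers `Z(𝔤_j)` for `j < ℓ`; as a
result, `GZ(𝔤_k)` is a commutative subalgebra").
[cite: BergEtAl2024, §4.5, p.22 (PDF p.23)] locator: paper:arxiv-2411.03444 p0023.txt:L37–L39 -/
theorem gzAlgebra_commute {x y : UniversalEnvelopingAlgebra ℂ (T → Matrix (Fin k) (Fin k) ℂ)}
    (hx : x ∈ gzAlgebra T k) (hy : y ∈ gzAlgebra T k) : x * y = y * x :=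
  (Algebra.commute_of_mem_adjoin_of_forall_mem_commute hy fun _ hb =>
    (Algebra.commute_of_mem_adjoin_of_forall_mem_commute hx fun _ ha =>
      gzGenerators_commute hb ha).symm).eq

/-- **`GZ(gl_k)` is generated by the Casimir elements `C_{ℓ,p}`, `1 ≤ p ≤ ℓ ≤ k`** — the
generation clause of "`GZ(𝔤_k) = ℂ[C_{ℓ,p}]` generated by the Casimir elements (14)", in the
one-block model `T₀ = (ℝ →ₐ[ℝ] ℂ)` where the tree's Thm. 4.13 (`center_eq_adjoin_casimir`:
`Z(gl_ℓ) = ℂ[C_{ℓ,1},…,C_{ℓ,ℓ}]`) lives. (The joint algebraic independence of the `k(k+1)/2`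
generators — "polynomial algebra" — is not typed here; level by level it is
`algebraicIndependent_casimirC`.)
[cite: BergEtAl2024, §4.5 eq. (14), p.23 (PDF p.24)] locator: paper:arxiv-2411.03444 p0024.txt:L5–L13 -/
theorem gzAlgebra_eq_adjoin_casimirLevel [DecidableEq (ℝ →ₐ[ℝ] ℂ)] :
    gzAlgebra (ℝ →ₐ[ℝ] ℂ) k =
      Algebra.adjoin ℂ {x | ∃ (ℓ' : Fin (k + 1)) (τ : ℝ →ₐ[ℝ] ℂ) (p : Fin ℓ'),
        x = casimirLevel k (level_le ℓ') τ ((p : ℕ) + 1)} := by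
  apply le_antisymm
  · refine Algebra.adjoin_le ?_
    rintro x hx
    obtain ⟨ℓ', hx⟩ := Set.mem_iUnion.1 hx
    obtain ⟨z, hz, rfl⟩ := hx
    -- `z ∈ Z(gl_ℓ') = ℂ[C_{ℓ',1}, …, C_{ℓ',ℓ'}]`
    rw [SetLike.mem_coe, center_eq_adjoin_casimir (k := (ℓ' : ℕ))] at hz
    have hmap : envLiftT (T := (ℝ →ₐ[ℝ] ℂ)) (level_le ℓ') z ∈
        (Algebra.adjoin ℂ (Set.range fun q : (ℝ →ₐ[ℝ] ℂ) × Fin ℓ' =>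
          (casimir (ℓ' : ℕ) q.1 ((q.2 : ℕ) + 1) :
            UniversalEnvelopingAlgebra ℂ ((ℝ →ₐ[ℝ] ℂ) → Matrix (Fin ℓ') (Fin ℓ') ℂ)))).map
          (envLiftT (T := (ℝ →ₐ[ℝ] ℂ)) (level_le ℓ')) :=
      Subalgebra.mem_map.2 ⟨z, hz, rfl⟩
    rw [AlgHom.map_adjoin] at hmap
    refine Algebra.adjoin_mono ?_ hmap
    rintro _ ⟨_, ⟨q, rfl⟩, rfl⟩
    exact ⟨ℓ', q.1, q.2, rfl⟩
  · refine Algebra.adjoin_le ?_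
    rintro x ⟨ℓ', τ, p, rfl⟩
    exact casimirLevel_mem_gzAlgebra ℓ' τ _

end GZ

/-! ### `C_{ℓ,p}` acts on the `T`-isotypic spaces by the Perelomov–Popov scalars -/

section Action

variable {k d : ℕ} {T : Type*} [Fintype T] [DecidableEq T] (τ₀ : T)

/-- **On the `T`-isotypic space, `C_{ℓ,p}` is the scalar `χ_T(C_{ℓ,p}) = χ_{λ^{(ℓ)}}(C_p) = Tr(A_{λ^{(ℓ)}}^p E)`**
("the operators `C_{ℓ,p}` of `GZ(gl_k)` act on this space as multiplications by the corresponding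
eigenvalues `χ_T(C_{ℓ,p})`", with (9) for the value): for `Δ` homogeneous of degree `δ` in
`gtSubspace (coordRep) T` and a level `ℓ ≤ k`, `C_{ℓ,p}.Δ = Tr(A_{T_ℓ}^p E) Δ`.
[cite: BergEtAl2024, §4.5 and eq. (9), p.23 and p.21 (PDF p.24, p.22)] locator: paper:arxiv-2411.03444 p0024.txt:L55–L57, p0022.txt:L32–L45 -/
theorem envActGL_casimirLevel_apply_of_mem_gtSubspace {δ : ℕ} {P : GTPattern k}
    {Δ : MvPolynomial (DegIdx (Fin k) d) ℂ} (hΔ : Δ.IsHomogeneous δ)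
    (hΔP : Δ ∈ gtSubspace (coordRep (Fin k) ℂ d) P) (ℓ' : Fin (k + 1)) (p : ℕ) :
    envActGL k d τ₀ (casimirLevel k (level_le ℓ') τ₀ p) Δ =
      Matrix.trace (ppMatrix (fun i : Fin ℓ' => ((P ℓ' i : ℤ) : ℂ)) ^ p *
        Matrix.of fun _ _ : Fin ℓ' => (1 : ℂ)) • Δ := by
  classical
  have hΔℓ := (mem_gtSubspace_iff _ _ _).1 hΔP ℓ'
  by_cases hΔ0 : Δ = 0
  · rw [hΔ0, map_zero, smul_zero]
  -- a nonzero level-`ℓ'` highest weight vector of weight `P ℓ'`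
  obtain ⟨v, hv, hv0⟩ := (Submodule.ne_bot_iff _).1
    (mem_weightBox_of_mem_hwSubrep_glLift (level_le ℓ') hΔ hΔℓ hΔ0).2
  have hvC := isHighestWeightVectorC_glLift τ₀ (level_le ℓ') hv hv0
  rw [casimirLevel, envLiftT_center_apply_of_mem_hwSubrep τ₀ (level_le ℓ') hΔ hΔℓ
    (casimir_mem_center_level τ₀ p), eval_hcProj_casimir_eq_trace hvC τ₀ p, blockWt_self_fun]

end Action


/-! ### Different Gelfand–Tsetlin patterns have different Gelfand–Tsetlin characters -/

section Separation

attribute [local instance] Literature.NumberTheory.Automorphic.HCCore.idxLinearOrder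

open Literature.Algebra.Lie.PBW Literature.RingTheory.MvPolynomial.BlockSymmetric

variable {k d : ℕ}

/-- **"Theorem 4.11 implies that different Gelfand–Tsetlin patterns correspond to different
Gelfand–Tsetlin characters"**: if two distinct patterns `T ≠ T'` both occur in the degree-`δ`
metapolynomials, some element `X ∈ GZ(gl_k)` — a central element of some `U(gl_j)` of length `≤ k`,
pushed along the chain — acts on `V_T ∩ ℂ[ℂ[x]_d]_δ` and on `V_{T'} ∩ ℂ[ℂ[x]_d]_δ` by two DIFFERENT
scalars `χ_T(X) ≠ χ_{T'}(X)` (one block `T₀ = (ℝ →ₐ[ℝ] ℂ)`, where the tree's Harish-Chandra isomorphism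
lives; the level `j` with `λ^{(j)} ≠ λ'^{(j)}`, Thm. 4.11 at rank `j`: `exists_esymm_shiftedWt_ne` +
`exists_center_fil_gamma_eq`, the same step as inside `cor_5_8_length`).
[cite: BergEtAl2024, §4.5, p.22 (PDF p.23)] locator: paper:arxiv-2411.03444 p0023.txt:L40–L47 -/
theorem exists_gzAlgebra_separates [DecidableEq (ℝ →ₐ[ℝ] ℂ)] (τ₀ : ℝ →ₐ[ℝ] ℂ) {δ : ℕ}
    {P P' : GTPattern k} (hne : P ≠ P')
    (hP : ∃ x : MvPolynomial (DegIdx (Fin k) d) ℂ,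
      x.IsHomogeneous δ ∧ x ≠ 0 ∧ x ∈ gtSubspace (coordRep (Fin k) ℂ d) P)
    (hP' : ∃ x : MvPolynomial (DegIdx (Fin k) d) ℂ,
      x.IsHomogeneous δ ∧ x ≠ 0 ∧ x ∈ gtSubspace (coordRep (Fin k) ℂ d) P') :
    ∃ X ∈ gzAlgebra (ℝ →ₐ[ℝ] ℂ) k, X ∈ fil (stdB (ℝ →ₐ[ℝ] ℂ) k) k ∧ ∃ c c' : ℂ, c ≠ c' ∧
      (∀ Δ : MvPolynomial (DegIdx (Fin k) d) ℂ, Δ.IsHomogeneous δ →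
          Δ ∈ gtSubspace (coordRep (Fin k) ℂ d) P → envActGL k d τ₀ X Δ = c • Δ) ∧
      (∀ Δ : MvPolynomial (DegIdx (Fin k) d) ℂ, Δ.IsHomogeneous δ →
          Δ ∈ gtSubspace (coordRep (Fin k) ℂ d) P' → envActGL k d τ₀ X Δ = c' • Δ) := by
  classical
  -- a level where the patterns differ; both level weights occur and are dominant
  obtain ⟨j, hj⟩ := Function.ne_iff.1 hne
  obtain ⟨x, hxδ, hx0, hxP⟩ := hP
  obtain ⟨x', hx'δ, hx'0, hx'P⟩ := hP'
  have hocc := (mem_weightBox_of_mem_hwSubrep_glLift (level_le j) hxδ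
    ((mem_gtSubspace_iff _ _ _).1 hxP j) hx0).2
  have hocc' := (mem_weightBox_of_mem_hwSubrep_glLift (level_le j) hx'δ
    ((mem_gtSubspace_iff _ _ _).1 hx'P j) hx'0).2
  obtain ⟨v, hv, hv0⟩ := (Submodule.ne_bot_iff _).1 hocc
  obtain ⟨w, hw, hw0⟩ := (Submodule.ne_bot_iff _).1 hocc'
  obtain ⟨q, hq, hneq⟩ := exists_esymm_shiftedWt_ne
    (isDominant_of_mem_highestWeightSpace
      (isRationalRep_comp_glLift (isRationalRep_coordRep d) (level_le j)) hv hv0)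
    (isDominant_of_mem_highestWeightSpace
      (isRationalRep_comp_glLift (isRationalRep_coordRep d) (level_le j)) hw hw0) hj
  have hqj : q ≤ (j : ℕ) := by have := Finset.mem_range.1 hq; omega
  -- Thm. 4.13 at rank `j`: a central element of length `≤ j` with Harish-Chandra image `e_q`
  have γ : HarishChandraHomGL ℝ (j : ℕ) := Classical.choice (nonempty_harishChandraHomGL_holds ℝ (j : ℕ))
  obtain ⟨z, hzfil, hzγ⟩ := exists_center_fil_gamma_eq γ.hasHWProperty_complexified γ.complexified_mem
    (j : ℕ) _ (besymm_mem τ₀ q)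
    ((besymm_isHomogeneous (R := ℂ) (n := (j : ℕ)) τ₀ q).totalDegree_le.trans hqj)
  refine ⟨envLiftT (level_le j) (z : UniversalEnvelopingAlgebra ℂ
      ((ℝ →ₐ[ℝ] ℂ) → Matrix (Fin (j : ℕ)) (Fin (j : ℕ)) ℂ)), envLiftT_mem_gzAlgebra j z.2,
    fil_mono _ (level_le j) (envLiftT_mem_fil (level_le j) hzfil),
    MvPolynomial.eval (fun p : (ℝ →ₐ[ℝ] ℂ) × Fin (j : ℕ) => blockWt τ₀ (P j) p.1 p.2)
      (hcProj (ℝ →ₐ[ℝ] ℂ) (j : ℕ) z),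
    MvPolynomial.eval (fun p : (ℝ →ₐ[ℝ] ℂ) × Fin (j : ℕ) => blockWt τ₀ (P' j) p.1 p.2)
      (hcProj (ℝ →ₐ[ℝ] ℂ) (j : ℕ) z), ?_, ?_, ?_⟩
  · -- the two scalars are `e_q(λ^{(j)} + ρ) ≠ e_q(λ'^{(j)} + ρ)`
    rw [eval_hcProj_eq_aeval_complexified_glLift (d := d) τ₀ (level_le j) γ hocc,
      eval_hcProj_eq_aeval_complexified_glLift (d := d) τ₀ (level_le j) γ hocc', hzγ, aeval_besymm,
      aeval_besymm]
    simp only [blockWt_self]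
    exact hneq
  · intro Δ hΔ hΔP
    exact envLiftT_center_apply_of_mem_hwSubrep τ₀ (level_le j) hΔ ((mem_gtSubspace_iff _ _ _).1 hΔP j) z.2
  · intro Δ hΔ hΔP'
    exact envLiftT_center_apply_of_mem_hwSubrep τ₀ (level_le j) hΔ ((mem_gtSubspace_iff _ _ _).1 hΔP' j) z.2

end Separation
end BergEtAl2024

end Literature.Barriers.ValiantsHypothesis
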